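import Summits.QuantumFields.BalabanUV.T4Continuum.Support.ShellMeasureRootCompositionSUN
import Summits.QuantumFields.BalabanUV.T4Continuum.Support.ShellMeasureRootCompositionNoFinite

/-!
# `T4Continuum.ShellMeasureRootCompositionSUNNoFinite` — END-II FOR `SU(N)` WITHOUT THE FINITENESS PROVISO: the
# `SU(N)` twin of `ShellMeasureRootCompositionNoFinite` — leaf-08-g7's `slotAC_realized_suN_of_levelData_ball(_raw)`
# with the per-section finiteness binder `hfin` GONE for every slot with `0 < #Λ·d_N`
(cell `pub-balaban`, sub-cell `t4`, spine estimate NE7c (node U5b); NE7c formalisation swarm, crew seat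
`b2b-balaban-t4-ne7c-formalise-leaf-02` gen 5, idle-seat corollary; imports `ShellMeasureRootCompositionSUN` (p216198,
leaf-08-g7) and `ShellMeasureRootCompositionNoFinite` (p216335, this seat) ONLY; [folklore]; 0 `def`, 0 `def … : Prop`,
0 sorry, 0 citations)

HONEST FRAMING.  Finite four-torus programme, rung (B)+1 only — NOT infinite volume, NOT a mass gap, NOT the Clay
problem, NOT summit progress.  NE7c (`T4IndicatorShell.ShellWeightBound`) is NOT PRINTED and NOT PROVED; «NE7c ⇐ the
named binders»; row S3 (the `SU(N)` road) is c5-optional, `SU(2)` the certified instance.  A LOGICAL remark on OUR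
composition (the binder is idle), nothing about Bałaban's (finite) block sections; NOTHING in the countdown moves.

THE POINT.  As in `ShellMeasureRootCompositionNoFinite` for `SU(2)`: (M1) reads `μ(shell) ≤ ofReal (Dρ)·μ univ`, free
on a measure of infinite mass when `0 < D` (`slotAntiConcentration_of_measure_univ_eq_top`).  END-II for `SU(N)`
(`ShellMeasureRootCompositionSUN`) is proved SECTION BY SECTION on the block chart (`slotAC_realized_suN_of_chartAC`),
its `hfin` serving only the one-depth assembly A3 on FINITE sections; the chart law has the section's mass
(`ShellMeasureScalingSUN.chartLaw_univ_eq` with (CH)₁ = the theorem `haar_restrict_expBallSU_le`), and the constant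
`2(#Λ·d_N + β Σ_p L̄_p(d̄_p + 4s̄_p) + B_𝓔)/(1−δ)` is POSITIVE once `0 < #Λ·d_N` (a block with a bond, `N ≥ 2`).  Hence
* `slotAC_realized_suN_of_levelData_ball_raw_nofin`, `slotAC_realized_suN_of_levelData_ball_nofin` — leaf-08-g7's two
  END-II theorems WORD FOR WORD with `hfin` GONE and `hd : 0 < Λ.card * dimSU N` ADDED; finite sections = their
  chart-level argument verbatim, infinite ones free.
NOT an estimate; NE7c NOT PROVED; spine PROVED 0/9.  HONEST DEPENDENCY (cell): continuum YM on T⁴ ⇐ BetaPertH ∧ nine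
spine estimates (0/9 proved); BetaPertH ⇐ (D1) ∧ (D4) ∧ CAP+tail; G-an2-4 gates asym, D1 and NE2/3/4.
-/

noncomputable section

open NormedSpace Set Function MeasureTheory Metric

namespace Summit.QuantumFields.BalabanUV.T4Continuum.ShellMeasureRootCompositionSUNNoFinite

open scoped ENNReal
open Literature.MathematicalPhysics.QuantumFieldTheory.Balaban1983to89
open GaugeField (GaugeInvariant)
open T4ShellMeasure (SlotAntiConcentration)
open T4ShellMeasureDet (blockLaw)
open T4TreeGaugeFixing (NoClosedLoop fixTo measurable_fixTo)
open ShellMeasureScalingLocal (slotAntiConcentration_gaugeFixed_iff)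
open ShellMeasureExpChartSUN
open ShellMeasureScalingSUN (windowSU chartLaw_univ_eq chartWeightSU_le_smul_of_pos)
open ShellMeasureExpJacobianSUN (expJacWeightSU measurable_expJacWeightSU expJacWeightSU_le_smul)
open ShellMeasureExpHaarAreaSUN (kappaSU)
open ShellMeasureExpHaarClosedBallSUN (haar_restrict_expBallSU_le)
open ShellMeasureWilsonTrace (TraceData)
open ShellMeasureWilsonMoving (MLetter mwordEval mdFro sSum lSum)
open ShellMeasureLevelAssembly (classifier weight slotAntiConcentration_of_levelData)
open ShellMeasureRootCompositionSUN (slotAntiConcentration_congr_ae ae_eq_of_eqOn_offNull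
  slotAC_realized_suN_of_chartAC)
open ShellMeasureRootCompositionNoFinite (slotAntiConcentration_of_measure_univ_eq_top)

variable {N : ℕ} [NeZero N] {P : Params} {j : ℕ} [DecidableEq (PBond P j)]
variable {A : Type*} [NormedRing A] [NormedAlgebra ℂ A] [CompleteSpace A] [NormOneClass A]

/-- **END-II FOR `G = SU(N)` ON RAW SECTIONS, NO FINITENESS PROVISO.**
`ShellMeasureRootCompositionSUN.slotAC_realized_suN_of_levelData_ball_raw` WORD FOR WORD (chart bonds `Λ`, `0 ≤ S ≤ π`,
centres `c V`, measurable block weights `R V`, measurable `F` with the window factorisation `hFw` of its raw sections,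
measurable `u`; level data `Ttr`, `hol`, `G`, `𝓔`, `W`, `Jco`, sizes, numbers; binders `hRdict`/`hudict` on the chart
ball, `hJW`/`hJ`, `hRad`/`hAN`, `hGW`, `hE`/`hB𝓔`, `hSM`) EXCEPT: `hfin` GONE, `hd : 0 < #Λ·d_N` ADDED.  CONCLUSION
(unchanged): `SlotAntiConcentration ((fieldMeasure P j SU(N)).withDensity F) u θ ρ (2(#Λ·d_N + β Σ_p L̄_p(d̄_p + 4s̄_p) + B_𝓔)/(1−δ))`.
CONDITIONAL on every binder; nothing PRINTED is asserted. [folklore] -/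
theorem slotAC_realized_suN_of_levelData_ball_raw_nofin (Λ : Finset (PBond P j)) (hd : 0 < Λ.card * dimSU N)
    {S : ℝ} (hS : 0 ≤ S) (hSπ : S ≤ Real.pi)
    (c : GaugeField P j (SUN N) → GaugeField P j (SUN N))
    {R : GaugeField P j (SUN N) → (↥Λ → SUN N) → ℝ≥0∞} (hR : ∀ V, Measurable (R V))
    {F : GaugeField P j (SUN N) → ℝ≥0∞} (hF : Measurable F)
    (hFw : ∀ V y, F (updateFinset V Λ y) = windowSU Λ (c V) S y * R V y)
    {u : GaugeField P j (SUN N) → ℝ} (hu : Measurable u)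
    -- level data per exterior section
    (Ttr : TraceData A) (hN : 0 < Ttr.N) {ι κ : Type*} {Pu : Finset ι} (hPu : Pu.Nonempty)
    (hol : GaugeField P j (SUN N) → ι → BlockChartSU N Λ → A) (hcont : ∀ V, ∀ p ∈ Pu, Continuous (hol V p))
    (Pw : Finset κ) (G : GaugeField P j (SUN N) → κ → BlockChartSU N Λ → A)
    (𝓔 : GaugeField P j (SUN N) → BlockChartSU N Λ → ℝ)
    (W : GaugeField P j (SUN N) → Set (BlockChartSU N Λ)) (Jco : GaugeField P j (SUN N) → BlockChartSU N Λ → ℝ≥0∞)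
    {θ δ ρ β Rad H B𝓔 : ℝ} {sw lw dw : κ → ℝ}
    -- DICTIONARY (block weight, tested variable: on the chart ball only, RAW sections)
    (hRdict : ∀ V, ∀ x ∈ closedBall (0 : BlockChartSU N Λ) S,
      R V (expFibreChartSU Λ (c V) x) = Jco V x * weight Ttr β Pw (G V) (𝓔 V) x)
    (hudict : ∀ V, ∀ x ∈ closedBall (0 : BlockChartSU N Λ) S,
      u (updateFinset V Λ (expFibreChartSU Λ (c V) x)) = classifier hPu (hol V) x)
    -- SM-L5/L6: kept co-tests supported in the window, centre-monotone
    (hJW : ∀ V x, Jco V x ≠ 0 → x ∈ W V)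
    (hJ : ∀ V x, ∀ a : ℝ, 0 ≤ a → Jco V x ≤ Jco V (Real.exp (-a) • x))
    -- SM-L1 (AN-bound)
    (hRad : 1 < Rad)
    (hAN : ∀ V, ∀ x ∈ W V, ∀ p ∈ Pu, ∃ f : ℂ → A, DifferentiableOn ℂ f (ball 0 Rad) ∧
      (∀ w ∈ ball (0 : ℂ) Rad, ‖f w‖ ≤ H) ∧ f 0 = 0 ∧ ∀ c' : ℝ, 0 ≤ c' → c' ≤ 1 → f (c' : ℂ) = hol V p (c' • x) - 1)
    -- SM-L3 graded sectioned words
    (hGW : ∀ V, ∀ x ∈ W V, ∀ p ∈ Pw, ∃ gw : List (MLetter A × ℝ × ℝ), (∀ y ∈ gw, y.1.Good Ttr.τ y.2.1 y.2.2) ∧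
      sSum gw ≤ sw p ∧ lSum gw ≤ lw p ∧ mdFro (gw.map Prod.fst) ≤ dw p ∧
      ∀ c' : ℝ, 0 ≤ c' → c' ≤ 1 → mwordEval c' (gw.map Prod.fst) = G V p (c' • x))
    (hsw1 : ∀ p ∈ Pw, sw p ≤ 1) (hsw0 : ∀ p ∈ Pw, 0 ≤ sw p) (hlw0 : ∀ p ∈ Pw, 0 ≤ lw p)
    (hdw0 : ∀ p ∈ Pw, 0 ≤ dw p)
    -- SM-L4 non-Wilson ray bound
    (hE : ∀ V, ∀ x ∈ W V, ∀ c' : ℝ, 1 / 2 ≤ c' → c' ≤ 1 → 𝓔 V (c' • x) ≤ 𝓔 V x + (1 - c') * B𝓔) (hB𝓔 : 0 ≤ B𝓔)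
    -- numbers + SM-L2 (SM)
    (hθ : 0 < θ) (hδ0 : 0 ≤ δ) (hδ1 : δ < 1) (hρ0 : 0 ≤ ρ) (hρ : ρ ≤ (1 - δ) / 2) (hβ : 0 ≤ β)
    (hSM : 36 * H * 1 ^ 2 / (Rad - 1) ^ 2 ≤ δ * θ) :
    SlotAntiConcentration ((fieldMeasure P j (SUN N)).withDensity F) u θ ρ
      (2 * (((Λ.card * dimSU N : ℕ) : ℝ) + (β * ∑ p ∈ Pw, lw p * (dw p + 4 * sw p) + B𝓔)) / (1 - δ)) := by
  refine slotAC_realized_suN_of_chartAC Λ hS hSπ c hR hF hFw hu fun V => ?_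
  have hsecF : (fun y => F (updateFinset V Λ y)) = fun y => windowSU Λ (c V) S y * R V y := funext (hFw V)
  by_cases hinf : ((blockLaw Λ).withDensity fun y => F (updateFinset V Λ y)) univ = ∞
  · -- an INFINITE section: the chart law has the same (infinite) mass and the constant is positive
    have hmass : ((volume : Measure (BlockChartSU N Λ)).withDensity fun x =>
        chartWeightSU Λ S (expJacWeightSU (kappaSU N)) x * R V (expFibreChartSU Λ (c V) x)) univ = ∞ := by
      rw [chartLaw_univ_eq Λ (c V) hS (measurable_expJacWeightSU (kappaSU N)) (haar_restrict_expBallSU_le hSπ) (hR V),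
        ← hsecF]
      exact hinf
    have hsum : 0 ≤ ∑ p ∈ Pw, lw p * (dw p + 4 * sw p) := Finset.sum_nonneg fun p hp =>
      mul_nonneg (hlw0 p hp) (by linarith [hdw0 p hp, hsw0 p hp])
    have hD : 0 < 2 * (((Λ.card * dimSU N : ℕ) : ℝ) + (β * ∑ p ∈ Pw, lw p * (dw p + 4 * sw p) + B𝓔)) / (1 - δ) := by
      have hd' : (0 : ℝ) < ((Λ.card * dimSU N : ℕ) : ℝ) := Nat.cast_pos.2 hd
      have hpos : 0 < ((Λ.card * dimSU N : ℕ) : ℝ) + (β * ∑ p ∈ Pw, lw p * (dw p + 4 * sw p) + B𝓔) := by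
        nlinarith [mul_nonneg hβ hsum]
      exact div_pos (by linarith) (by linarith)
    exact slotAntiConcentration_of_measure_univ_eq_top _ hρ0 hD hmass
  · -- a FINITE section: leaf-08-g7's chart-level argument verbatim
    have hoff : ∀ x ∉ closedBall (0 : BlockChartSU N Λ) S, chartWeightSU Λ S (expJacWeightSU (kappaSU N)) x = 0 :=
      fun x hx => by
        by_contra h
        exact hx (mem_closedBall_of_chartWeightSU_ne_zero Λ h)
    have hdens : (fun x : BlockChartSU N Λ =>
          chartWeightSU Λ S (expJacWeightSU (kappaSU N)) x * R V (expFibreChartSU Λ (c V) x)) =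
        fun x => (chartWeightSU Λ S (expJacWeightSU (kappaSU N)) x * Jco V x) * weight Ttr β Pw (G V) (𝓔 V) x := by
      funext x
      by_cases hx : x ∈ closedBall (0 : BlockChartSU N Λ) S
      · rw [hRdict V x hx, mul_assoc]
      · simp only [hoff x hx, zero_mul]
    rw [hdens]
    have hfin' : ((volume : Measure (BlockChartSU N Λ)).withDensity fun x =>
        (chartWeightSU Λ S (expJacWeightSU (kappaSU N)) x * Jco V x) * weight Ttr β Pw (G V) (𝓔 V) x)
          {x | classifier hPu (hol V) x < θ} ≠ ∞ := by
      refine ne_top_of_le_ne_top ?_ (measure_mono (subset_univ _))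
      rw [← hdens, chartLaw_univ_eq Λ (c V) hS (measurable_expJacWeightSU (kappaSU N))
          (haar_restrict_expBallSU_le hSπ) (hR V), ← hsecF]
      exact hinf
    have h := slotAntiConcentration_of_levelData (volume : Measure (BlockChartSU N Λ)) Ttr hN hPu (hol V) (hcont V)
      Pw (G V) (𝓔 V) (W := W V ∩ closedBall (0 : BlockChartSU N Λ) S)
      (J := fun x => chartWeightSU Λ S (expJacWeightSU (kappaSU N)) x * Jco V x)
      (fun x hx => ⟨hJW V x (right_ne_zero_of_mul hx),
        mem_closedBall_of_chartWeightSU_ne_zero Λ (left_ne_zero_of_mul hx)⟩)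
      (fun x a ha => mul_le_mul' (chartWeightSU_le_smul_of_pos Λ (expJacWeightSU_le_smul (kappaSU N) hSπ) ha x)
        (hJ V x a ha)) hRad
      (fun x hx p hp => hAN V x hx.1 p hp) (fun x hx p hp => hGW V x hx.1 p hp) hsw1 hsw0 hlw0 hdw0
      (fun x hx c' h1 h2 => hE V x hx.1 c' h1 h2) hB𝓔 hθ hδ0 hδ1 hρ0 hρ hβ hSM hfin'
    rw [finrank_blockChart] at h
    exact slotAntiConcentration_congr_ae (ae_eq_of_eqOn_offNull volume measurableSet_closedBall
      (fun x hx => by simp only [hoff x hx, zero_mul]) (hudict V)) h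

/-- **END-II FOR `G = SU(N)` THROUGH THE TREE GAUGE, NO FINITENESS PROVISO** —
`ShellMeasureRootCompositionSUN.slotAC_realized_suN_of_levelData_ball` WORD FOR WORD with `hfin` GONE and
`hd : 0 < #Λ·d_N` ADDED (tree `T` loop-free, any `U₀`; gauge-invariant measurable `F`, `u`; window factorisation and
dictionary on the TREE-GAUGED sections); the raw form transported by
`ShellMeasureScalingLocal.slotAntiConcentration_gaugeFixed_iff`.  CONCLUSION: unchanged. [folklore] -/
theorem slotAC_realized_suN_of_levelData_ball_nofin {T : Finset (PBond P j)} (hT : NoClosedLoop T)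
    (U₀ : GaugeField P j (SUN N)) (Λ : Finset (PBond P j)) (hd : 0 < Λ.card * dimSU N)
    {S : ℝ} (hS : 0 ≤ S) (hSπ : S ≤ Real.pi)
    (c : GaugeField P j (SUN N) → GaugeField P j (SUN N))
    {R : GaugeField P j (SUN N) → (↥Λ → SUN N) → ℝ≥0∞} (hR : ∀ V, Measurable (R V))
    {F : GaugeField P j (SUN N) → ℝ≥0∞} (hF : Measurable F) (hFi : GaugeInvariant F)
    (hFw : ∀ V y, F (fixTo T U₀ (updateFinset V Λ y)) = windowSU Λ (c V) S y * R V y)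
    {u : GaugeField P j (SUN N) → ℝ} (hu : Measurable u) (hui : GaugeInvariant u)
    -- level data per exterior section
    (Ttr : TraceData A) (hN : 0 < Ttr.N) {ι κ : Type*} {Pu : Finset ι} (hPu : Pu.Nonempty)
    (hol : GaugeField P j (SUN N) → ι → BlockChartSU N Λ → A) (hcont : ∀ V, ∀ p ∈ Pu, Continuous (hol V p))
    (Pw : Finset κ) (G : GaugeField P j (SUN N) → κ → BlockChartSU N Λ → A)
    (𝓔 : GaugeField P j (SUN N) → BlockChartSU N Λ → ℝ)
    (W : GaugeField P j (SUN N) → Set (BlockChartSU N Λ)) (Jco : GaugeField P j (SUN N) → BlockChartSU N Λ → ℝ≥0∞)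
    {θ δ ρ β Rad H B𝓔 : ℝ} {sw lw dw : κ → ℝ}
    -- DICTIONARY (block weight, tested variable: on the chart ball only, TREE-GAUGED sections)
    (hRdict : ∀ V, ∀ x ∈ closedBall (0 : BlockChartSU N Λ) S,
      R V (expFibreChartSU Λ (c V) x) = Jco V x * weight Ttr β Pw (G V) (𝓔 V) x)
    (hudict : ∀ V, ∀ x ∈ closedBall (0 : BlockChartSU N Λ) S,
      u (fixTo T U₀ (updateFinset V Λ (expFibreChartSU Λ (c V) x))) = classifier hPu (hol V) x)
    -- SM-L5/L6: kept co-tests supported in the window, centre-monotone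
    (hJW : ∀ V x, Jco V x ≠ 0 → x ∈ W V)
    (hJ : ∀ V x, ∀ a : ℝ, 0 ≤ a → Jco V x ≤ Jco V (Real.exp (-a) • x))
    -- SM-L1 (AN-bound)
    (hRad : 1 < Rad)
    (hAN : ∀ V, ∀ x ∈ W V, ∀ p ∈ Pu, ∃ f : ℂ → A, DifferentiableOn ℂ f (ball 0 Rad) ∧
      (∀ w ∈ ball (0 : ℂ) Rad, ‖f w‖ ≤ H) ∧ f 0 = 0 ∧ ∀ c' : ℝ, 0 ≤ c' → c' ≤ 1 → f (c' : ℂ) = hol V p (c' • x) - 1)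
    -- SM-L3 graded sectioned words
    (hGW : ∀ V, ∀ x ∈ W V, ∀ p ∈ Pw, ∃ gw : List (MLetter A × ℝ × ℝ), (∀ y ∈ gw, y.1.Good Ttr.τ y.2.1 y.2.2) ∧
      sSum gw ≤ sw p ∧ lSum gw ≤ lw p ∧ mdFro (gw.map Prod.fst) ≤ dw p ∧
      ∀ c' : ℝ, 0 ≤ c' → c' ≤ 1 → mwordEval c' (gw.map Prod.fst) = G V p (c' • x))
    (hsw1 : ∀ p ∈ Pw, sw p ≤ 1) (hsw0 : ∀ p ∈ Pw, 0 ≤ sw p) (hlw0 : ∀ p ∈ Pw, 0 ≤ lw p)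
    (hdw0 : ∀ p ∈ Pw, 0 ≤ dw p)
    -- SM-L4 non-Wilson ray bound
    (hE : ∀ V, ∀ x ∈ W V, ∀ c' : ℝ, 1 / 2 ≤ c' → c' ≤ 1 → 𝓔 V (c' • x) ≤ 𝓔 V x + (1 - c') * B𝓔) (hB𝓔 : 0 ≤ B𝓔)
    -- numbers + SM-L2 (SM)
    (hθ : 0 < θ) (hδ0 : 0 ≤ δ) (hδ1 : δ < 1) (hρ0 : 0 ≤ ρ) (hρ : ρ ≤ (1 - δ) / 2) (hβ : 0 ≤ β)
    (hSM : 36 * H * 1 ^ 2 / (Rad - 1) ^ 2 ≤ δ * θ) :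
    SlotAntiConcentration ((fieldMeasure P j (SUN N)).withDensity F) u θ ρ
      (2 * (((Λ.card * dimSU N : ℕ) : ℝ) + (β * ∑ p ∈ Pw, lw p * (dw p + 4 * sw p) + B𝓔)) / (1 - δ)) :=
  (slotAntiConcentration_gaugeFixed_iff hT U₀ hF hFi hu hui).1
    (slotAC_realized_suN_of_levelData_ball_raw_nofin Λ hd hS hSπ c hR (hF.comp (measurable_fixTo T U₀)) hFw
      (hu.comp (measurable_fixTo T U₀)) Ttr hN hPu hol hcont Pw G 𝓔 W Jco hRdict hudict hJW hJ hRad hAN hGW hsw1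
      hsw0 hlw0 hdw0 hE hB𝓔 hθ hδ0 hδ1 hρ0 hρ hβ hSM)

end Summit.QuantumFields.BalabanUV.T4Continuum.ShellMeasureRootCompositionSUNNoFinite

end
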